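import Literature.Barriers.QuantumAdvantage.TensorNetworkContractionTreewidth
import Literature.Computability.Complexity.PlumbingBricks
import Literature.Computability.Complexity.UnaryBricks
import Literature.Computability.Cryptography.QuantumCircuitDescFP
import Literature.Computability.QuantumComplexity.ZOmegaCodesFP
import HarnessLib

/-!
# Barrier catalogue `QuantumAdvantage` — Markov–Shi Thm 4.6: the language-level assembly around the contraction engine

Companion to `TensorNetworkContractionTreewidth.lean` (the named fact `markovShi2008_thm46`:
a language decided with bounded error by a uniform polynomial-size oracle-free Clifford+`T`
family `C_n`, for which a polynomial-time function `1ⁿ ↦ 𝒯_n` supplies rooted tree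
decompositions of the circuit graphs `G_{C_n}` of width `≤ c·log₂ n + c`, is in `P`).
Markov–Shi prove Thm 4.6 by the four-step algorithm of §4 (p. 10 of the arXiv version):
"1. Construct `N = N(C; x, τ)`. 2. [Robertson–Seymour: a tree decomposition `𝒯` — supplied, in
the restated fact]. 3. Find a contraction ordering `π` from `𝒯` (Proposition 4.2). 4. Contract
`N` using `π`, and output the desired probability from the final (rank-0) tensor
(Proposition 3.5)", Step 4 costing `O(T exp[O(d)])` (Proposition 3.6). At the language level
the polynomial-time decider is therefore: from `x` produce the description of `C_{|x|}`
(uniformity) and the decomposition `𝒯_{|x|}` (the hypothesis `d ∈ FP`), run Steps 1, 3, 4 with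
a unary yardstick of length `≥ 2^{width 𝒯}` (a polynomial in `n`, since the width is
`≤ c log₂ n + c`) so that "`exp[O(d)]`" is polynomial in the padded input, obtain the exact
probability `p = (u + v√2)/2^h`, and accept iff `p > 1/2` (the exact sign of
`2u − 2^h + 2v√2`, `posSqrtTwoTest`).

This file proves that assembly, isolating Steps 1, 3, 4 — the CONTRACTION ENGINE, the one
machine the discharge of `markovShi2008_thm46` still has to build — as an interface: the
hypothesis structure `ContractionEngine` bundles an `FP` string function with the property the
proof consumes (on `⟨x, ⟨sigmaEncode ⟨|x|, m, C⟩, ⟨𝒯.encode, y⟩⟩⟩` with `|y| ≥ 2^{width 𝒯}` it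
returns `probCode u v h` with `p · 2^h = u + v√2`). It is an interface, not a claim: it is
inhabited by writing and verifying the program (functional model: variable elimination over
the segment network `segmentNetwork C` along the decomposition `segDecomposition 𝒯`, exact
arithmetic in `ℤ[ω]`, `TensorNetworkContractionSegments*.lean`).

* `probCode u v h` — the record `⟨dpEnc u, ⟨dpEnc v, dpEnc 2^h⟩⟩` coding `(u + v√2)/2^h`;
* `ContractionEngine` — the interface of Steps 1, 3, 4;
* `yardFn c` (`|yardFn c x| = 2^c (|x|+1)^c ≥ 2^{c log₂|x| + c}`), `probThreshFn`
  (`probCode u v h ↦ [p > 1/2]`, `posSqrtTwoTest_eq_decide`);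
* `probFn`, `deciderFn` (`∈ FP` for uniform families, `deciderFn_spec`: value `[p > 1/2]`);
* **`markovShi2008_thm46_of_engine`** — any contraction engine proves `markovShi2008_thm46`
  (`mem_P_of_mem_FP` under the `(2/3, 1/3)` gap).

## References

* [MarkovShi2008] I. L. Markov, Y. Shi, *Simulating quantum computation by contracting tensor
  networks*, SIAM J. Comput. 38 (2008) 963–981 (arXiv:quant-ph/0511069): §4, Thm 4.6 and its
  proof (Steps 1–4), Prop 4.2; §3, Prop 3.5, Prop 3.6; §1, Thm 1.1, Cor 1.2. Read via
  `lit read paper:arxiv-quant-ph_0511069` (pp. 7–10).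
* [AroraBarak2009] S. Arora, B. Barak, *Computational Complexity: A Modern Approach*, CUP 2009,
  §1.3 (closure of polynomial time under composition), §0.1 (codes).
-/

noncomputable section

open Computability Polynomial
open Literature.Computability.Complexity Literature.Computability.Complexity.Classes
open Literature.Computability.Complexity.Brick Literature.Computability.Cryptography
open Literature.Computability.QuantumComplexity Literature.Combinatorics.SimpleGraph

namespace Literature.Barriers.QuantumAdvantage

/-! ### The code of an exact probability and the interface of the contraction engine -/

/-- **The code of an exact probability** `p = (u + v√2)/2^h`: the record
`⟨dpEnc u, ⟨dpEnc v, dpEnc 2^h⟩⟩` of canonical integer codes (`Brick.dpEnc`). [folklore] -/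
def probCode (u v : ℤ) (h : ℕ) : List Bool :=
  boolPair (dpEnc u) (boolPair (dpEnc v) (dpEnc (2 ^ h)))

/-- **Steps 1, 3, 4 of the proof of Thm 4.6 (Prop 4.2, Prop 3.5, Prop 3.6, with Lemma 4.4) as
an interface** — the contraction engine: an `FP` string function which, on
`⟨x, ⟨sigmaEncode ⟨|x|, m, C⟩, ⟨𝒯.encode, y⟩⟩⟩` with `C` an oracle-free Clifford+`T` circuit on
`|x| + m` wires, `𝒯` a rooted tree decomposition of its circuit graph
(`RootedTreeDecomposition.encode`) and `|y| ≥ 2^{width 𝒯}` (so that "`exp[O(d)]`" is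
polynomial in the input length), returns `probCode u v h` with `p · 2^h = u + v√2`, where `p`
is the probability that wire `0` reads `1` after running `C` on `|x⟩|0^m⟩` ("contract `N` using
`π`, and output the desired probability from the final (rank-0) tensor"). An interface, not a
claim: it is inhabited by constructing the machine.
[cite: MarkovShi2008, §4 (proof of Thm 4.6, Steps 1, 3, 4; Prop 4.2) and §3 (Prop 3.5, Prop 3.6)] -/
structure ContractionEngine where
  /-- The contraction algorithm as a string function. -/
  fn : List Bool → List Bool
  /-- It is polynomial-time (on the padded input). -/
  mem_FP : fn ∈ FP
  /-- On well-formed padded inputs it returns an exact code of the acceptance probability. -/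
  spec : ∀ (x : List Bool) (m : ℕ) (C : QCircuit cliffordT (x.length + m)), C.IsOracleFree →
    ∀ (k : ℕ) (D : RootedTreeDecomposition (circuitGraph C) k) (y : List Bool),
      2 ^ D.width ≤ y.length →
      ∃ (u v : ℤ) (h : ℕ),
        fn (boolPair x (boolPair (QCircuit.sigmaEncode (G := cliffordT) ⟨x.length, m, C⟩)
          (boolPair D.encode y))) = probCode u v h ∧
        (C.acceptProb 0 x.get : ℝ) * 2 ^ h = u + v * Real.sqrt 2

/-! ### The yardstick -/

/-- The yardstick polynomial `2^c · (X + 1)^c`. [folklore] -/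
def yardPoly (c : ℕ) : Polynomial ℕ := Polynomial.C (2 ^ c) * (X + 1) ^ c

/-- Evaluation of the yardstick polynomial. [folklore] -/
@[simp] theorem yardPoly_eval (c n : ℕ) : (yardPoly c).eval n = 2 ^ c * (n + 1) ^ c := by
  simp [yardPoly]

/-- **`yardFn c x = 1^{2^c (|x|+1)^c}`**, the unary yardstick handed to the engine
(`Plumb.polyFn`). [folklore] -/
def yardFn (c : ℕ) : List Bool → List Bool := Plumb.polyFn (yardPoly c)

/-- Length of the yardstick. [folklore] -/
@[simp] theorem length_yardFn (c : ℕ) (x : List Bool) :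
    (yardFn c x).length = 2 ^ c * (x.length + 1) ^ c := by
  simp [yardFn]

/-- `yardFn c ∈ FP`. [folklore] -/
theorem yardFn_mem_FP (c : ℕ) : yardFn c ∈ FP := Plumb.polyFn_mem_FP _

/-- **The yardstick is long enough**: `2^{c log₂ n + c} ≤ 2^c (n+1)^c`, since
`2^{⌊log₂ n⌋} ≤ n + 1`. [folklore] -/
theorem two_pow_le_yardPoly_eval (c n : ℕ) : 2 ^ (c * Nat.log 2 n + c) ≤ (yardPoly c).eval n := by
  have hlog : 2 ^ Nat.log 2 n ≤ n + 1 := by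
    rcases Nat.eq_zero_or_pos n with rfl | hn
    · simp
    · exact (Nat.pow_log_le_self 2 hn.ne').trans (Nat.le_succ n)
  rw [yardPoly_eval, pow_add, mul_comm c (Nat.log 2 n), pow_mul, mul_comm]
  exact Nat.mul_le_mul_left _ (Nat.pow_le_pow_left hlog _)

/-! ### The threshold brick: `p > 1/2` from `probCode` -/

/-- **`probThreshFn ⟨U, ⟨V, W⟩⟩ = [0 < (ival U + ival U − ival W) + (ival V + ival V)·√2]`**
(`ZWCode.posTestF` after the integer bricks `zaddF`/`zsubF`); on `probCode u v h` this is the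
bit `[p > 1/2]` for `p · 2^h = u + v√2` (`probThreshFn_probCode`, `posSqrtTwoTest_eq_decide`).
[folklore] -/
def probThreshFn : List Bool → List Bool :=
  ZWCode.posTestF ∘ fanoutFn (zsubF ∘ fanoutFn (zaddF ∘ fanoutFn fstF fstF) (sndF ∘ sndF))
    (zaddF ∘ fanoutFn (fstF ∘ sndF) (fstF ∘ sndF))

/-- `probThreshFn ∈ FP`. [folklore] -/
theorem probThreshFn_mem_FP : probThreshFn ∈ FP :=
  comp_mem_FP ZWCode.posTestF_mem_FP (fanoutFn_mem_FP
    (comp_mem_FP zsubF_mem_FP (fanoutFn_mem_FP (comp_mem_FP zaddF_mem_FP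
      (fanoutFn_mem_FP fstF_mem_FP fstF_mem_FP)) (comp_mem_FP sndF_mem_FP sndF_mem_FP)))
    (comp_mem_FP zaddF_mem_FP (fanoutFn_mem_FP (comp_mem_FP fstF_mem_FP sndF_mem_FP)
      (comp_mem_FP fstF_mem_FP sndF_mem_FP))))

/-- Value of `probThreshFn` on a probability code. [folklore] -/
theorem probThreshFn_probCode (u v : ℤ) (h : ℕ) :
    probThreshFn (probCode u v h) = [posSqrtTwoTest (u + u - 2 ^ h) (v + v)] := by
  simp only [probThreshFn, probCode, Function.comp_apply, fanoutFn_apply, fstF_boolPair,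
    sndF_boolPair, zaddF_boolPair, zsubF_boolPair, ival_dpEnc, ZWCode.posTestF_boolPair]

/-- **The threshold is `p > 1/2`**: for `p · 2^h = u + v√2`,
`posSqrtTwoTest (2u − 2^h) (2v) = [1/2 < p]`. [folklore] -/
theorem posSqrtTwoTest_eq_decide {p : ℝ} {u v : ℤ} {h : ℕ}
    (hp : p * 2 ^ h = u + v * Real.sqrt 2) :
    posSqrtTwoTest (u + u - 2 ^ h) (v + v) = decide (1 / 2 < p) := by
  have hpos : (0 : ℝ) < 2 ^ h := by positivity
  have key : posSqrtTwoTest (u + u - 2 ^ h) (v + v) = true ↔ 1 / 2 < p := by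
    rw [posSqrtTwoTest_iff]
    push_cast
    constructor
    · intro h0
      by_contra hle
      rw [not_lt] at hle
      nlinarith [hp, hle, hpos]
    · intro hlt
      nlinarith [hp, hlt, hpos]
  by_cases hq : 1 / 2 < p
  · rw [decide_eq_true hq]
    exact key.2 hq
  · rw [decide_eq_false hq]
    cases hb : posSqrtTwoTest (u + u - 2 ^ h) (v + v)
    · rfl
    · exact absurd (key.1 hb) hq

/-! ### The decider and the assembly of Thm 4.6 -/

section Assembly

variable (B : ContractionEngine) (c : ℕ) (F : QCircuitFamily cliffordT) (d : List Bool → List Bool)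

/-- The argument handed to the engine on input `x` (`n = |x|`):
`⟨x, ⟨desc C_n, ⟨d 1ⁿ, yardstick⟩⟩⟩` — the description by uniformity (`QCircuitFamily.descFn`),
the decomposition by the supplier `d`. [cite: MarkovShi2008, §4 (proof of Thm 4.6, Steps 1–2)] -/
def probArgFn : List Bool → List Bool :=
  fanoutFn id (fanoutFn F.descFn (fanoutFn (d ∘ onesFn) (yardFn c)))

/-- **The probability of `x`, exactly**: the code `probCode u v h` of
`P[wire 0 of C_{|x|} on |x 0…0⟩ reads 1]` (the engine run on `probArgFn`).
[cite: MarkovShi2008, §4 (proof of Thm 4.6)] -/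
def probFn : List Bool → List Bool := B.fn ∘ probArgFn c F d

/-- **The decider**: accept iff the exact probability exceeds `1/2`.
[cite: MarkovShi2008, §4 (Thm 4.6) and §1 (Cor 1.2)] -/
def deciderFn : List Bool → List Bool := probThreshFn ∘ probFn B c F d

/-- `probFn ∈ FP` for a uniform family and an `FP` supplier (composition of `FP` functions).
[cite: AroraBarak2009, §1.3 (polynomial time is closed under composition)] -/
theorem probFn_mem_FP (hU : F.IsUniform) (hd : d ∈ FP) : probFn B c F d ∈ FP :=
  comp_mem_FP B.mem_FP (fanoutFn_mem_FP OracleCompose.id_mem_FP (fanoutFn_mem_FP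
    (QCircuitFamily.descFn_mem_FP_of_isUniform hU)
    (fanoutFn_mem_FP (comp_mem_FP hd onesFn_mem_FP) (yardFn_mem_FP c))))

/-- `deciderFn ∈ FP` for a uniform family and an `FP` supplier. [cite: AroraBarak2009, §1.3] -/
theorem deciderFn_mem_FP (hU : F.IsUniform) (hd : d ∈ FP) : deciderFn B c F d ∈ FP :=
  comp_mem_FP probThreshFn_mem_FP (probFn_mem_FP B c F d hU hd)

/-- **Correctness of the probability function**: for an oracle-free family and a supplier of
rooted decompositions of width `≤ c log₂ n + c`, `probFn` returns an exact code of the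
acceptance probability — the yardstick has length `2^c (n+1)^c ≥ 2^{c log₂ n + c} ≥ 2^{width}`.
[cite: MarkovShi2008, §4 (proof of Thm 4.6)] -/
theorem probFn_spec (hOF : F.IsOracleFree)
    (hd : ∀ n, ∃ (k : ℕ) (D : RootedTreeDecomposition (circuitGraph (F.circ n)) k),
      D.width ≤ c * Nat.log 2 n + c ∧ d (unaryEncodeNat n) = D.encode) (x : List Bool) :
    ∃ (u v : ℤ) (h : ℕ), probFn B c F d x = probCode u v h ∧
      F.acceptProbOn 0 x * 2 ^ h = u + v * Real.sqrt 2 := by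
  obtain ⟨k, D, hw, hdD⟩ := hd x.length
  have hwid : 2 ^ D.width ≤ (yardFn c x).length :=
    calc 2 ^ D.width ≤ 2 ^ (c * Nat.log 2 x.length + c) := Nat.pow_le_pow_right two_pos hw
      _ ≤ (yardPoly c).eval x.length := two_pow_le_yardPoly_eval c x.length
      _ = (yardFn c x).length := by rw [length_yardFn, yardPoly_eval]
  obtain ⟨u, v, h, hB, hp⟩ :=
    B.spec x (F.ancillas x.length) (F.circ x.length) (hOF _) k D _ hwid
  refine ⟨u, v, h, ?_, hp⟩
  rw [probFn, Function.comp_apply, probArgFn, fanoutFn_apply, fanoutFn_apply, fanoutFn_apply,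
    Function.comp_apply, onesFn, hdD]
  exact hB

/-- **The decider decides `p > 1/2`** under the same hypotheses. [cite: MarkovShi2008, §4 (Thm 4.6)] -/
theorem deciderFn_spec (hOF : F.IsOracleFree)
    (hd : ∀ n, ∃ (k : ℕ) (D : RootedTreeDecomposition (circuitGraph (F.circ n)) k),
      D.width ≤ c * Nat.log 2 n + c ∧ d (unaryEncodeNat n) = D.encode) (x : List Bool) :
    deciderFn B c F d x = [decide (1 / 2 < F.acceptProbOn 0 x)] := by
  obtain ⟨u, v, h, hprob, hp⟩ := probFn_spec B c F d hOF hd x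
  rw [deciderFn, Function.comp_apply, hprob, probThreshFn_probCode, posSqrtTwoTest_eq_decide hp]

end Assembly

/-- **Markov–Shi 2008, Thm 4.6 (given the decomposition of its Step 2) at the language level,
from a contraction engine.** Given Steps 1, 3, 4 as a machine (`ContractionEngine`: Props 4.2,
3.5, 3.6), a language decided with error `≤ 1/3` by a polynomial-time uniform, polynomial-size,
oracle-free Clifford+`T` family with `FP`-supplied rooted tree decompositions of the circuit
graphs of width `≤ c log₂ n + c` is in `P`: the decider `deciderFn` is in `FP`
(`deciderFn_mem_FP`) and computes `[p > 1/2]` (`deciderFn_spec`), which under the `(2/3, 1/3)`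
gap is `[x ∈ L]` (`mem_P_of_mem_FP`).
[cite: MarkovShi2008, §4 (Thm 4.6 and its proof) and §1 (Thm 1.1, Cor 1.2)] -/
theorem markovShi2008_thm46_of_engine (B : ContractionEngine) : markovShi2008_thm46 := by
  rintro c F L hOF hU - ⟨d, hdFP, hd⟩ hDec
  refine mem_P_of_mem_FP (deciderFn_mem_FP B c F d hU hdFP) L fun x => ⟨fun hx => ?_, fun hx => ?_⟩
  · have h12 : (1 : ℝ) / 2 < F.acceptProbOn 0 x := by linarith [(hDec x).1 hx]
    rw [deciderFn_spec B c F d hOF hd x, decide_eq_true h12]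
  · have h12 : ¬ (1 : ℝ) / 2 < F.acceptProbOn 0 x := fun hlt => by
      linarith [(hDec x).2 hx]
    rw [deciderFn_spec B c F d hOF hd x, decide_eq_false h12]

end Literature.Barriers.QuantumAdvantage

end
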